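import Literature.MathematicalPhysics.QuantumFieldTheory.Balaban1983to89.B9Eq360Vprime

/-!
# `Balaban1983to89.B9Eq361VprimeAnalytic` — [Balaban1985BackgroundPropagators] Sect. B, pp. 402–403 and 407: THE ANALYTICITY SENTENCES
# OF THE SECT. B STEP AT THE RING-LETTER LEVEL — «It [V′(A)] is an analytic function of A on the domain (3.37)» (p. 402, after (3.61)),
# «Each term in the series is analytic in A …, hence G′(U′U) is an analytic function of A also» (p. 402, after (3.64)), «Each term of the
# series is an analytic function of A on the domain (3.37)» (p. 403, after (3.67)), «These results imply that the operators R(U), P(U) = I − R(U)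
# extend analytically to the domain (3.37)» (p. 403, before (3.68)), «The operators V₃(A), P₁(A), P₂(A) depend analytically on A … Each
# term in the series is an analytic function of A in the domain (3.37)» (p. 407, (3.84)–(3.86)) — kernel-checked as COMPOSITION facts:
# the printed words `V′(A)` (3.60), `C′(A)` (3.65)bis, `(Q′G′²Q′*)(U′U)⁻¹` (3.67), `P(U′U)`/`P′(A)` (3.68), `V(A)` (3.84), `G(U′U)` (3.86)
# are analytic functions of `A` as soon as their LETTERS are (seat r06 gen 26 of cell `lit-balaban`; rows B9.Eq3.60, 3.66, 3.68, 3.82;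
# member cells only, no head changes)

statement-level skeleton of published theorems with citation tags; proofs where landed; nothing here is a claim about the Yang–Mills mass gap

CITATION HEADER (lean-in-tree rule).  B9 = T. Bałaban, *Propagators for lattice gauge theories in a background field*, Commun. Math. Phys. **99**
(1985) 389–434 (held `paper:balaban1985-cmp99-background-propagators`, journal page = PDF page + 388; pp. 402–403 = renders `…-p014-x2.png`,
`…-p015-x2.png` READ AS IMAGES by this seat 2026-08-24, p. 407 = text layer p0019).  WHAT IS IN PRINT (verbatim): p. 402 «where V′(A) is defined
by the last equality. It satisfies the bound (3.61) … It is an analytic function of A on the domain (3.37), for α₁ sufficiently small.» — «The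
operator F′_{2,j}(A) is an analytic function of A in the domain given by the inequality |A| < α₁(Lʲη)⁻¹ for α₁ sufficiently small.» — «This
implies the existence of the operator G′(U′U) and the equality G′(U′U) = G′(U)(I − V′(A)G′(U))⁻¹ = Σ_{n=0}^∞ G′(U)(V′(A)G′(U))ⁿ. (3.64) Each
term in the series is analytic in A on the domain (3.37), and the series is convergent uniformly, hence G′(U′U) is an analytic function of A
also.»; p. 403 «Let us consider the operator (Q′(U)G′²(U)Q′*(U))⁻¹. Its inverse can be analytically continued to configurations U′U and has
the expansion … = Q′(U)G′²(U)Q′*(U) + C′(A), (3.65) where the operator C′(A) is defined by the last equality. … Using Theorem 3.2 and the above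
bound we obtain Q′(U′U)G′²(U′U)Q′*(U′U) = (I + C′(A)(Q′(U)G′²(U)Q′*(U))⁻¹)·Q′(U)G′²(U)Q′*(U), … (3.67) thus the operators in the equality are
invertible and an inverse of the left-hand side can be expressed by a Neumann series convergent for α₁ sufficiently small. Each term of the
series is an analytic function of A on the domain (3.37). The inverse satisfies Theorem 3.2. These results imply that the operators R(U),
P(U) = I − R(U) extend analytically to the domain (3.37) and satisfy the same bounds, e.g. the operator P(U′U) satisfies the bounds (3.49).
Moreover we have P(U′U) = P(U) + P′(A), … (3.68)»; p. 407 «The operators V₃(A), P₁(A), P₂(A) depend analytically on A in the domain (3.37).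
Let us denote the sum of these three operators by V(A). … G(U′U) = G(U)(I − V(A)G(U))⁻¹ = Σ_{n=0}^∞ G(U)(V(A)G(U))ⁿ, (3.86) and convergence is
in the operator norm for α₁ sufficiently mall [sic]. Each term in the series is an analytic function of A in the domain (3.37).»; Theorem 3.4
p. 400 «… extend to configurations U′U for α₁ ≦ a₁ as analytic functions of A.»

WHAT THIS FILE PROVES (theorems only: 0 `def`, 0 named fact, 0 sorry; Mathlib's `AnalyticAt` calculus — `AnalyticAt.add/sub/neg/mul/comp`,
`analyticAt_inverse`, `Units.oneSub` — and the tree's ring-letter words BY NAME: `B9Eq360Vprime.vPrime` (3.60), `gPrimeExt` (3.64), `cPrime`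
(3.65)bis, `pOp`/`pPrime` (3.25)/(3.68); `B9Eq386Neumann.vThree` (3.82), `pOne` (3.76), `pTwo` (3.83), `vTotal` (3.84), `gNew` (3.86); the
Neumann-series analyticity `B9Eq386NeumannAnalytic.analyticAt_gNew_comp` / `B9Eq360Vprime.analyticAt_gPrimeExt_comp`).  SETTING: `R` a normed
algebra over a nontrivially normed field `𝕜` (print: `𝕜 = ℂ`, `R` = the operators on the finite lattice), `E` a normed `𝕜`-space of
configurations `A`, and LETTER MAPS `E → R` (`B ↦ V′₁(B)`, `B ↦ F′₂(B)`, …) analytic at a configuration `A`; the `U`-letters (`Q′(U)`,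
`Q′*(U)`, `a`, `G′(U)`, `D_U`, `D*_U`, `(Q′G′²Q′*)(U)` and its inverse) are constants.
* §1 **`analyticAt_vPrime`** — «It [V′(A)] is an analytic function of A»: `B ↦ V′(B) = V′₁(B) − (F′₂*(B)aQ′ + Q′*aF′₂(B) + F′₂*(B)aF′₂(B))`
  is analytic at `A` when `V′₁`, `F′₂`, `F′₂*` are (their analyticity = the printed sentences after (3.51) and (3.59): rows B9.Eq3.50 / B9.Eq3.58,
  `B9Eq352Analytic`, `B9Eq358Analytic`); `analyticOnNhd_vPrime` («on the domain (3.37)»: any set `D`); **`analyticAt_gPrimeExt_vPrime`** —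
  «hence G′(U′U) is an analytic function of A also» for `G′(U′U) = gPrimeExt G′(U) (V′(·))` under `‖V′(A)G′(U)‖ < 1` ((3.63) «for α₁
  sufficiently small»).
* §2 **`analyticAt_cPrime`** — «Each term of the series is an analytic function of A» for the p. 403 word `C′(A)` (six terms in `F′₂(A)`,
  `F′₂*(A)`, `G′(U′U)(A)`, `V′(A)` and the constants `Q′(U)`, `Q′*(U)`, `G′(U)`); **`isUnit_add_of_norm_mul_inv_lt_one`** — (3.67) «thus the
  operators in the equality are invertible»: `L + C′` is a unit when `L` is and `‖C′L⁻¹‖ < 1` (`L + C′ = (1 + C′L⁻¹)L`, `Units.oneSub`);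
  **`analyticAt_inverse_add_comp`** — the inverse `B ↦ (L + C′(B))⁻¹` (`Ring.inverse`) is analytic at `A` when `C′` is and `L + C′(A)` is a unit
  (Mathlib's `analyticAt_inverse` composed) — «Its inverse can be analytically continued to configurations U′U».
* §3 **`analyticAt_pOp`** — `B ↦ P(U′U)(B) = E(B)Q′*(U′U)(B)C⁻¹(U′U)(B)Q′(U′U)(B)E(B)` analytic when its four letter maps are; **`analyticAt_pPrime`**
  — `P′(A) = P(U′U) − P(U)` analytic; **`analyticAt_one_sub_pOp`** — `R(U′U) = I − P(U′U)` analytic («R(U), P(U) = I − R(U) extend analytically»).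
* §4 **`analyticAt_vThree`**, **`analyticAt_pOne`**, **`analyticAt_pTwo`**, **`analyticAt_vTotal`** — the G-side words of (3.76)/(3.82)/(3.83)/(3.84)
  are analytic when their `A`-letters are (for the concrete `V₃` the letters' analyticity is pv27's `B9Eq373V3Analytic`); **`analyticAt_gNew_vTotal`**
  — «Each term in the series is an analytic function of A» ⟹ `G(U′U) = gNew G(U) (V(·))` analytic under `‖V(A)G(U)‖ < 1` ((3.85)).

HONEST SCOPE / NOT CLAIMED.  Ring-letter level only (the algebra of analytic maps into a normed algebra): the analyticity of the ELEMENTARY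
letters `A ↦ V′₁(A)`, `F′₂(A)`, `F′₂*(A)`, `V₃(A)`, `D_{U′U} − D_U`, `D*_{U′U} − D*_U`, `Q′(U′U)` is NOT proved here — it is the content of the
printed sentences after (3.51), (3.59), (3.83) (rows B9.Eq3.50 `B9Eq352Analytic`, B9.Eq3.58 `B9Eq358Analytic`, B9.Eq3.82 `B9Eq373V3Analytic`, on
their own carriers) and enters as `AnalyticAt` hypotheses; the smallness conditions (3.63)/(3.67)/(3.85) enter as norm hypotheses; no bound,
no domain geometry (the set `D` is a parameter standing for (3.37)); the identification of `R` with an operator algebra on the lattice and of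
the letter maps with the Sect. B objects of the r06 chain (`vPrimeConc`, FILES 20–61: a REAL scalar block carrier where `A` is not a variable)
is NOT made — this file is the composition bookkeeping of the printed «analytic in A» sentences, nothing more.  No row head changes.

RELATED IN THE TREE, NOT DUPLICATED (searched 2026-08-24: `grep analyticAt_vPrime|analyticAt_cPrime|analyticAt_pOp|analyticAt_pPrime|
analyticAt_vTotal|analyticAt_pOne|analyticAt_pTwo` over `Balaban1983to89/` = ∅): `B9Eq386NeumannAnalytic` (NE9 seat: `analyticAt_term`,
`analyticAt_inverse_one_sub_comp`, `analyticAt_gNew_comp` — the Neumann step, USED here), `B9Eq360Vprime` §9 (`analyticAt_gPrimeExt_comp`, USED),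
`B9Eq373V3Analytic`/`B9Eq382V3NormAnalytic` (pv27: `V₃` entrywise on the lattice carrier), `B9Eq352Analytic` (r06 g22: `F′_{1,k}`, `V′₁`),
`B9Eq358Analytic` (p06: `F′_{2,j}`).
-/

namespace Literature.MathematicalPhysics.QuantumFieldTheory.Balaban1983to89.B9Eq361VprimeAnalytic

open B9Eq360Vprime (vPrime gPrimeExt cPrime pOp pPrime analyticAt_gPrimeExt_comp)
open B9Eq386Neumann (pOne pTwo vThree vTotal gNew)
open B9Eq386NeumannAnalytic (analyticAt_gNew_comp)

variable {𝕜 : Type*} [NontriviallyNormedField 𝕜]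
variable {R : Type*} [NormedRing R] [NormedAlgebra 𝕜 R]
variable {E : Type*} [NormedAddCommGroup E] [NormedSpace 𝕜 E]

/-! ## §1 `V′(A)` of (3.60) and `G′(U′U)` of (3.64) -/

/-- **«It is an analytic function of A»** (p. 402, after (3.61)) at the ring-letter level: if the letters `B ↦ V′₁(B)`, `B ↦ F′₂(B)`,
`B ↦ F′₂*(B)` are analytic at `A`, so is `B ↦ V′(B) = V′₁(B) − (F′₂*(B)aQ′(U) + Q′*(U)aF′₂(B) + F′₂*(B)aF′₂(B))` (`B9Eq360Vprime.vPrime`;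
`Q′(U)`, `Q′*(U)`, `a` constant in `A`). [cite: Balaban1985BackgroundPropagators, (3.60)–(3.61) p.402] -/
theorem analyticAt_vPrime (Qs Q a : R) {V₁ F₂ F₂s : E → R} {A : E}
    (hV₁ : AnalyticAt 𝕜 V₁ A) (hF₂ : AnalyticAt 𝕜 F₂ A) (hF₂s : AnalyticAt 𝕜 F₂s A) :
    AnalyticAt 𝕜 (fun B => vPrime (V₁ B) Qs Q (F₂ B) (F₂s B) a) A := by
  have h1 : AnalyticAt 𝕜 (fun B => F₂s B * a * Q) A := (hF₂s.mul analyticAt_const).mul analyticAt_const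
  have h2 : AnalyticAt 𝕜 (fun B => Qs * a * F₂ B) A := analyticAt_const.mul hF₂
  have h3 : AnalyticAt 𝕜 (fun B => F₂s B * a * F₂ B) A := (hF₂s.mul analyticAt_const).mul hF₂
  have h := hV₁.sub ((h1.add h2).add h3)
  refine h.congr (Filter.Eventually.of_forall fun B => ?_)
  simp only [vPrime, Pi.add_apply, Pi.sub_apply]

/-- The same «on the domain (3.37)» (any set `D` of configurations). [cite: Balaban1985BackgroundPropagators, (3.61) p.402, (3.37) p.396] -/
theorem analyticOnNhd_vPrime (Qs Q a : R) {V₁ F₂ F₂s : E → R} {D : Set E}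
    (hV₁ : AnalyticOnNhd 𝕜 V₁ D) (hF₂ : AnalyticOnNhd 𝕜 F₂ D) (hF₂s : AnalyticOnNhd 𝕜 F₂s D) :
    AnalyticOnNhd 𝕜 (fun B => vPrime (V₁ B) Qs Q (F₂ B) (F₂s B) a) D :=
  fun A hA => analyticAt_vPrime Qs Q a (hV₁ A hA) (hF₂ A hA) (hF₂s A hA)

/-- The operator `V′(A)G′(U)` of (3.62)–(3.63) is analytic in `A` when `V′` is. [cite: Balaban1985BackgroundPropagators, (3.62)–(3.63) p.402] -/
theorem analyticAt_vPrime_mul (Gp Qs Q a : R) {V₁ F₂ F₂s : E → R} {A : E}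
    (hV₁ : AnalyticAt 𝕜 V₁ A) (hF₂ : AnalyticAt 𝕜 F₂ A) (hF₂s : AnalyticAt 𝕜 F₂s A) :
    AnalyticAt 𝕜 (fun B => vPrime (V₁ B) Qs Q (F₂ B) (F₂s B) a * Gp) A :=
  (analyticAt_vPrime Qs Q a hV₁ hF₂ hF₂s).mul analyticAt_const

/-- **«Each term in the series is analytic in A …, hence G′(U′U) is an analytic function of A also»** (p. 402, after (3.64)) with `V′(A)`
WRITTEN OUT in its letters: `B ↦ G′(U′U)(B) = gPrimeExt G′(U) (V′(B)) = G′(U)Σ_n(V′(B)G′(U))ⁿ` is analytic at `A` when `V′₁`, `F′₂`, `F′₂*`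
are analytic at `A` and `‖V′(A)G′(U)‖ < 1` ((3.63), «for α₁ sufficiently small»).  (`B9Eq360Vprime.analyticAt_gPrimeExt_comp` =
`B9Eq386NeumannAnalytic.analyticAt_gNew_comp`, composed with §1.) [cite: Balaban1985BackgroundPropagators, (3.64) p.402] -/
theorem analyticAt_gPrimeExt_vPrime [CompleteSpace R] (Gp Qs Q a : R) {V₁ F₂ F₂s : E → R} {A : E}
    (hV₁ : AnalyticAt 𝕜 V₁ A) (hF₂ : AnalyticAt 𝕜 F₂ A) (hF₂s : AnalyticAt 𝕜 F₂s A)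
    (h363 : ‖vPrime (V₁ A) Qs Q (F₂ A) (F₂s A) a * Gp‖ < 1) :
    AnalyticAt 𝕜 (fun B => gPrimeExt Gp (vPrime (V₁ B) Qs Q (F₂ B) (F₂s B) a)) A :=
  analyticAt_gPrimeExt_comp Gp (analyticAt_vPrime Qs Q a hV₁ hF₂ hF₂s) h363

/-! ## §2 `C′(A)` of (3.65)bis and the inverse `(Q′G′²Q′*)(U′U)⁻¹` of (3.67) -/

/-- **«Each term of the series is an analytic function of A»** (p. 403) for the word `C′(A)` of the p. 403 display (3.65): if `F′₂`, `F′₂*`,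
`G′(U′U)`, `V′` are analytic functions of `A` (at `A`), so is `C′(A) = F′₂G′²(U′U)Q′* + Q′G′²(U′U)F′₂* + F′₂G′²(U′U)F′₂* + Q′G′(U′U)V′G′²Q′* +
Q′G′²V′G′(U′U)Q′* + Q′G′V′G′²(U′U)V′G′Q′*` (`B9Eq360Vprime.cPrime`, constants `Q′(U)`, `Q′*(U)`, `G′(U)`).
[cite: Balaban1985BackgroundPropagators, (3.65)–(3.67) p.403] -/
theorem analyticAt_cPrime (Q Qs G : R) {F₂ F₂s Ex V : E → R} {A : E}
    (hF₂ : AnalyticAt 𝕜 F₂ A) (hF₂s : AnalyticAt 𝕜 F₂s A) (hE : AnalyticAt 𝕜 Ex A) (hV : AnalyticAt 𝕜 V A) :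
    AnalyticAt 𝕜 (fun B => cPrime Q Qs (F₂ B) (F₂s B) G (Ex B) (V B)) A := by
  have hEE : AnalyticAt 𝕜 (fun B => Ex B * Ex B) A := hE.mul hE
  have t1 : AnalyticAt 𝕜 (fun B => F₂ B * (Ex B * Ex B) * Qs) A := (hF₂.mul hEE).mul analyticAt_const
  have t2 : AnalyticAt 𝕜 (fun B => Q * (Ex B * Ex B) * F₂s B) A := (analyticAt_const.mul hEE).mul hF₂s
  have t3 : AnalyticAt 𝕜 (fun B => F₂ B * (Ex B * Ex B) * F₂s B) A := (hF₂.mul hEE).mul hF₂s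
  have t4 : AnalyticAt 𝕜 (fun B => Q * (Ex B * V B * (G * G)) * Qs) A :=
    (analyticAt_const.mul ((hE.mul hV).mul analyticAt_const)).mul analyticAt_const
  have t5 : AnalyticAt 𝕜 (fun B => Q * (G * G * V B * Ex B) * Qs) A :=
    (analyticAt_const.mul ((analyticAt_const.mul hV).mul hE)).mul analyticAt_const
  have t6 : AnalyticAt 𝕜 (fun B => Q * (G * V B * (Ex B * Ex B) * V B * G) * Qs) A :=
    (analyticAt_const.mul ((((analyticAt_const.mul hV).mul hEE).mul hV).mul analyticAt_const)).mul analyticAt_const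
  have h := ((((t1.add t2).add t3).add t4).add t5).add t6
  refine h.congr (Filter.Eventually.of_forall fun B => ?_)
  simp only [cPrime, Pi.add_apply]

/-- **(3.67) «thus the operators in the equality are invertible»** at the ring-letter level: if `L = Q′(U)G′²(U)Q′*(U)` is a unit and
`‖C′(A)L⁻¹‖ < 1`, then `L + C′(A) = (1 + C′(A)L⁻¹)L` is a unit (Neumann series, Mathlib's `Units.oneSub`).
[cite: Balaban1985BackgroundPropagators, (3.67) p.403] -/
theorem isUnit_add_of_norm_mul_inv_lt_one [HasSummableGeomSeries R] (L : Rˣ) (Cp : R) (h : ‖Cp * ↑L⁻¹‖ < 1) :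
    IsUnit ((L : R) + Cp) := by
  have hneg : ‖-(Cp * ↑L⁻¹)‖ < 1 := by rwa [norm_neg]
  have hu : IsUnit (1 - -(Cp * ↑L⁻¹)) := isUnit_one_sub_of_norm_lt_one hneg
  have hfac : (L : R) + Cp = (1 - -(Cp * ↑L⁻¹)) * L := by
    rw [sub_neg_eq_add, add_mul, one_mul, mul_assoc, Units.inv_mul, mul_one]
  rw [hfac]
  exact hu.mul L.isUnit

/-- **«Its inverse can be analytically continued to configurations U′U … Each term of the series is an analytic function of A»** (p. 403):
if `B ↦ C′(B)` is analytic at `A` and `L + C′(A)` is a unit, then `B ↦ (L + C′(B))⁻¹` (`Ring.inverse`) is analytic at `A` — Mathlib's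
`analyticAt_inverse` (the Neumann series around a unit) composed with `B ↦ L + C′(B)`. [cite: Balaban1985BackgroundPropagators, (3.65)–(3.67) p.403] -/
theorem analyticAt_inverse_add_comp [HasSummableGeomSeries R] (L : R) {Cp : E → R} {A : E} (hCp : AnalyticAt 𝕜 Cp A)
    (hunit : IsUnit (L + Cp A)) : AnalyticAt 𝕜 (fun B => Ring.inverse (L + Cp B)) A := by
  have h1 : AnalyticAt 𝕜 (fun B => L + Cp B) A := analyticAt_const.add hCp
  have h2 : AnalyticAt 𝕜 Ring.inverse (↑hunit.unit : R) := analyticAt_inverse (𝕜 := 𝕜) hunit.unit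
  exact h2.comp_of_eq h1 hunit.unit_spec.symm

/-- The two steps together: `C′` analytic at `A`, `L` a unit, `‖C′(A)L⁻¹‖ < 1` ⟹ `B ↦ (L + C′(B))⁻¹` analytic at `A`.
[cite: Balaban1985BackgroundPropagators, (3.67) p.403] -/
theorem analyticAt_inverse_add_comp_of_small [HasSummableGeomSeries R] (L : Rˣ) {Cp : E → R} {A : E} (hCp : AnalyticAt 𝕜 Cp A)
    (h : ‖Cp A * ↑L⁻¹‖ < 1) : AnalyticAt 𝕜 (fun B => Ring.inverse ((L : R) + Cp B)) A :=
  analyticAt_inverse_add_comp (L : R) hCp (isUnit_add_of_norm_mul_inv_lt_one L (Cp A) h)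

/-! ## §3 `P(U′U)`, `P′(A)` of (3.68) and `R(U′U) = I − P(U′U)` -/

/-- **«These results imply that the operators R(U), P(U) = I − R(U) extend analytically to the domain (3.37)»** (p. 403) — the word
`P(U′U) = G′(U′U)Q′*(U′U)(Q′G′²Q′*)(U′U)⁻¹Q′(U′U)G′(U′U)` (`B9Eq360Vprime.pOp`) is analytic at `A` when its letters are.
[cite: Balaban1985BackgroundPropagators, (3.68) p.403, (3.25) p.394] -/
theorem analyticAt_pOp {Ex Qs' Cinv' Q' : E → R} {A : E} (hE : AnalyticAt 𝕜 Ex A) (hQs : AnalyticAt 𝕜 Qs' A)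
    (hC : AnalyticAt 𝕜 Cinv' A) (hQ : AnalyticAt 𝕜 Q' A) :
    AnalyticAt 𝕜 (fun B => pOp (Ex B) (Qs' B) (Cinv' B) (Q' B)) A := by
  have h := (((hE.mul hQs).mul hC).mul hQ).mul hE
  refine h.congr (Filter.Eventually.of_forall fun B => ?_)
  simp only [pOp, Pi.mul_apply]

/-- `R(U′U) = I − P(U′U)` is analytic at `A` when `P(U′U)` is. [cite: Balaban1985BackgroundPropagators, (3.68) p.403] -/
theorem analyticAt_one_sub_pOp {Ex Qs' Cinv' Q' : E → R} {A : E} (hE : AnalyticAt 𝕜 Ex A) (hQs : AnalyticAt 𝕜 Qs' A)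
    (hC : AnalyticAt 𝕜 Cinv' A) (hQ : AnalyticAt 𝕜 Q' A) :
    AnalyticAt 𝕜 (fun B => 1 - pOp (Ex B) (Qs' B) (Cinv' B) (Q' B)) A :=
  analyticAt_const.sub (analyticAt_pOp hE hQs hC hQ)

/-- **`P′(A) = P(U′U) − P(U)` of (3.68) is analytic at `A`** when the extended letters are (the unextended word `P(U)` is a constant).
[cite: Balaban1985BackgroundPropagators, (3.68) p.403] -/
theorem analyticAt_pPrime (G Qs Cinv Q : R) {Ex Qs' Cinv' Q' : E → R} {A : E} (hE : AnalyticAt 𝕜 Ex A)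
    (hQs : AnalyticAt 𝕜 Qs' A) (hC : AnalyticAt 𝕜 Cinv' A) (hQ : AnalyticAt 𝕜 Q' A) :
    AnalyticAt 𝕜 (fun B => pPrime G (Ex B) Qs (Qs' B) Cinv (Cinv' B) Q (Q' B)) A := by
  have hc : AnalyticAt 𝕜 (fun _ : E => pOp G Qs Cinv Q) A := analyticAt_const
  have h := (analyticAt_pOp hE hQs hC hQ).sub hc
  refine h.congr (Filter.Eventually.of_forall fun B => ?_)
  simp only [pPrime, Pi.sub_apply]

/-! ## §4 The G-side words: `V₃(A)` (3.82), `P₁(A)` (3.76), `P₂(A)` (3.83), `V(A)` (3.84), `G(U′U)` (3.86) -/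

/-- `V₃(A) = V₁(A) − (Δ′(U′U) − Δ′(U)) + V₂(A)` (`B9Eq386Neumann.vThree`) is analytic at `A` when `V₁`, `V₂`, `Δ′(U′U)` are (for the concrete
lattice objects: pv27's `B9Eq373V3Analytic`). [cite: Balaban1985BackgroundPropagators, (3.82) p.407] -/
theorem analyticAt_vThree (Δp : R) {V₁ V₂ Δp' : E → R} {A : E} (hV₁ : AnalyticAt 𝕜 V₁ A) (hV₂ : AnalyticAt 𝕜 V₂ A)
    (hΔ : AnalyticAt 𝕜 Δp' A) : AnalyticAt 𝕜 (fun B => vThree (V₁ B) (V₂ B) Δp (Δp' B)) A := by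
  have h := (hV₁.sub (hΔ.sub (analyticAt_const (v := Δp)))).add hV₂
  refine h.congr (Filter.Eventually.of_forall fun B => ?_)
  simp only [vThree, Pi.add_apply, Pi.sub_apply]

/-- `P₁(A)` of (3.76) (`B9Eq386Neumann.pOne`: four words in `D_{U′U} − D_U`, `D*_{U′U} − D*_U`, `P(U)`, `P′(A)`) is analytic at `A` when
the extended letters `D_{U′U}`, `D*_{U′U}`, `P′(A)` are. [cite: Balaban1985BackgroundPropagators, (3.76) p.405, p.407] -/
theorem analyticAt_pOne (D Ds P : R) {D' Ds' Pp : E → R} {A : E} (hD : AnalyticAt 𝕜 D' A) (hDs : AnalyticAt 𝕜 Ds' A)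
    (hPp : AnalyticAt 𝕜 Pp A) : AnalyticAt 𝕜 (fun B => pOne D (D' B) Ds (Ds' B) P (Pp B)) A := by
  have hd : AnalyticAt 𝕜 (fun B => D' B - D) A := hD.sub analyticAt_const
  have hds : AnalyticAt 𝕜 (fun B => Ds' B - Ds) A := hDs.sub analyticAt_const
  have t1 : AnalyticAt 𝕜 (fun B => (D' B - D) * P * Ds) A := (hd.mul analyticAt_const).mul analyticAt_const
  have t2 : AnalyticAt 𝕜 (fun B => D * P * (Ds' B - Ds)) A := analyticAt_const.mul hds
  have t3 : AnalyticAt 𝕜 (fun B => (D' B - D) * P * (Ds' B - Ds)) A := (hd.mul analyticAt_const).mul hds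
  have t4 : AnalyticAt 𝕜 (fun B => D' B * Pp B * Ds' B) A := (hD.mul hPp).mul hDs
  have h := ((t1.add t2).add t3).add t4
  refine h.congr (Filter.Eventually.of_forall fun B => ?_)
  simp only [pOne, Pi.add_apply]

/-- `P₂(A) = −(F₂*aQ + Q*aF₂ + F₂*aF₂)` of (3.83) (`B9Eq386Neumann.pTwo`) is analytic at `A` when `F₂`, `F₂*` are.
[cite: Balaban1985BackgroundPropagators, (3.83) p.407] -/
theorem analyticAt_pTwo (Qs Q a : R) {F₂ F₂s : E → R} {A : E} (hF₂ : AnalyticAt 𝕜 F₂ A) (hF₂s : AnalyticAt 𝕜 F₂s A) :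
    AnalyticAt 𝕜 (fun B => pTwo Qs Q (F₂ B) (F₂s B) a) A := by
  have h1 : AnalyticAt 𝕜 (fun B => F₂s B * a * Q) A := (hF₂s.mul analyticAt_const).mul analyticAt_const
  have h2 : AnalyticAt 𝕜 (fun B => Qs * a * F₂ B) A := analyticAt_const.mul hF₂
  have h3 : AnalyticAt 𝕜 (fun B => F₂s B * a * F₂ B) A := (hF₂s.mul analyticAt_const).mul hF₂
  have h := ((h1.add h2).add h3).neg
  refine h.congr (Filter.Eventually.of_forall fun B => ?_)
  simp only [pTwo, Pi.add_apply, Pi.neg_apply]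

/-- **«The operators V₃(A), P₁(A), P₂(A) depend analytically on A … Let us denote the sum of these three operators by V(A)»** (p. 407):
`V(A) = V₃(A) + P₁(A) + P₂(A)` (`B9Eq386Neumann.vTotal`) is analytic at `A` when the three summands are.
[cite: Balaban1985BackgroundPropagators, (3.84) p.407] -/
theorem analyticAt_vTotal {V₃ P₁ P₂ : E → R} {A : E} (hV₃ : AnalyticAt 𝕜 V₃ A) (hP₁ : AnalyticAt 𝕜 P₁ A)
    (hP₂ : AnalyticAt 𝕜 P₂ A) : AnalyticAt 𝕜 (fun B => vTotal (V₃ B) (P₁ B) (P₂ B)) A := by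
  have h := (hV₃.add hP₁).add hP₂
  refine h.congr (Filter.Eventually.of_forall fun B => ?_)
  simp only [vTotal, Pi.add_apply]

/-- **«Each term in the series is an analytic function of A in the domain (3.37)»** (p. 407, after (3.86)) ⟹ `G(U′U) = gNew G(U) (V(·)) =
G(U)Σ_n(V(·)G(U))ⁿ` is analytic at `A` when `V₃`, `P₁`, `P₂` are analytic at `A` and `‖V(A)G(U)‖ < 1` ((3.85) «for α₁ sufficiently small») —
`B9Eq386NeumannAnalytic.analyticAt_gNew_comp` with `V(A)` written out. [cite: Balaban1985BackgroundPropagators, (3.84)–(3.86) p.407] -/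
theorem analyticAt_gNew_vTotal [CompleteSpace R] (G : R) {V₃ P₁ P₂ : E → R} {A : E} (hV₃ : AnalyticAt 𝕜 V₃ A)
    (hP₁ : AnalyticAt 𝕜 P₁ A) (hP₂ : AnalyticAt 𝕜 P₂ A) (h385 : ‖vTotal (V₃ A) (P₁ A) (P₂ A) * G‖ < 1) :
    AnalyticAt 𝕜 (fun B => gNew G (vTotal (V₃ B) (P₁ B) (P₂ B))) A :=
  analyticAt_gNew_comp G (analyticAt_vTotal hV₃ hP₁ hP₂) h385

end Literature.MathematicalPhysics.QuantumFieldTheory.Balaban1983to89.B9Eq361VprimeAnalytic
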